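import Mathlib
import Literature.Geometry.Symplectic.SteinBall
import Summits.SmoothPoincare4.SmoothPoincare4.Theorems.SullivanDualHyperbolicEndStubCollarLiouville

/-!
# `HyperbolicEnd` (stmt-SmoothPoincare4-7825), line `Sketch`, negative side — speed of a `J₀`-curve

Helper for the native frozen refutation of the flat certificate filling on `ℝ⁴ = ℂ²` with the
structure frozen to the standard `J₀ = stdComplexStructure`. Statement registered on the crux
item (stub helper_frozen_normSqDeriv).

**The statement.** Let `g : U → ℝ⁴` be smooth on the open set `U ⊆ ℂ` and `J₀`-holomorphic,
`Dg(z)(I ζ) = J₀ (Dg(z) ζ)`. Then the speed `m(w) = ‖Dg(w) 1‖²` is smooth on `U` and satisfies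
`m Δm - |∇m|² ≥ 0` there (`|∇m|² = (Dm(z) 1)² + (Dm(z) I)²`).

**The computation.** The complex coordinates `g₁ = (g)₀ + i (g)₁`, `g₂ = (g)₂ + i (g)₃` of `g` are
holomorphic on `U` (their real derivatives commute with `i` because the coordinate pairs
intertwine `J₀` with `i`), hence so are `h_j = g_j'`, and `m = |h₁|² + |h₂|²` on `U` since
`Dg(w) 1` has coordinate pairs `Dg_j(w) 1 = g_j'(w)`.  Along the real line `t ↦ z + t v` the slice
of `|h_j|²` has first derivative `2⟨h_j, h_j' v⟩` and second derivative
`2(⟨h_j, h_j'' v²⟩ + ‖h_j' v‖²)` at `t = 0` (`slice`); summing over `v = 1, I` the `h_j''` terms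
cancel, so `Δm = 4(|h₁'|² + |h₂'|²)` and `|∇m|² = 4 |h̄₁ h₁' + h̄₂ h₂'|²`, whence the Lagrange
identity `m Δm - |∇m|² = 4 |h₁ h₂' - h₂ h₁'|² ≥ 0` (`algebra_step`).
The one-variable reduction is copied from
`Theorems/HyperbolicEnd/Negative/CertificatePullback.lean`.
-/

noncomputable section

-- the prescribed namespace `Summit.<P>.<Sub>.…` duplicates `SmoothPoincare4` (P = Sub)
set_option linter.dupNamespace false

open scoped ContDiff Topology Real RealInnerProductSpace
open Laplacian Set Filter Metric Complex
open Literature.Geometry.Symplectic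
open Summit.SmoothPoincare4.SmoothPoincare4.Cruxes.HyperbolicEnd.Sketch

namespace Summit.SmoothPoincare4.SmoothPoincare4.Theorems.HyperbolicEnd.Negative

/-! ### One-variable reduction: derivatives along real lines -/

/-- **Line lemma.** For a real function `f` on `ℂ`, `C²` at `z`, the directional derivatives
`Df(z) v` and `D²f(z)[v, v]` are the first and second derivatives at `0` of the slice
`t ↦ f (z + t v)`, read off from one-variable `HasDerivAt` data
(copied from `Theorems/HyperbolicEnd/Negative/CertificatePullback.lean`). -/
private theorem fderiv_iteratedFDeriv_of_line {f : ℂ → ℝ} {z v : ℂ} (hf : ContDiffAt ℝ 2 f z)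
    {m₁ : ℝ → ℝ} {m₂ : ℝ}
    (h₁ : ∀ᶠ t in 𝓝 (0 : ℝ), HasDerivAt (fun s : ℝ => f (z + s * v)) (m₁ t) t)
    (h₂ : HasDerivAt m₁ m₂ 0) :
    fderiv ℝ f z v = m₁ 0 ∧ iteratedFDeriv ℝ 2 f z ![v, v] = m₂ := by
  -- the line through `z` in direction `v`
  set γ : ℝ → ℂ := fun t => z + t * v with hγ_def
  have hγ : ∀ t, HasDerivAt γ v t := fun t => by
    have h := (((hasDerivAt_id (t : ℂ)).mul_const v).const_add z).comp_ofReal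
    simpa [hγ_def] using h
  have hγ0 : γ 0 = z := by simp [hγ_def]
  -- `f` is differentiable near `z`, `Df` is differentiable at `z`
  have hev : ∀ᶠ y in 𝓝 z, DifferentiableAt ℝ f y := by
    filter_upwards [hf.eventually (by simp)] with y hy
    exact hy.differentiableAt (by simp)
  have hD : DifferentiableAt ℝ (fderiv ℝ f) z :=
    (hf.fderiv_right (m := 1) (by norm_num)).differentiableAt one_ne_zero
  -- the slice and its first derivative near `0`
  have hφ' : ∀ᶠ t in 𝓝 (0 : ℝ), HasDerivAt (fun s : ℝ => f (z + s * v)) (fderiv ℝ f (γ t) v) t := by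
    have : ∀ᶠ t in 𝓝 (0 : ℝ), DifferentiableAt ℝ f (γ t) := by
      have hcont : ContinuousAt γ 0 := (hγ 0).continuousAt
      rw [← hγ0] at hev
      exact hcont.eventually hev
    filter_upwards [this] with t ht
    exact ht.hasFDerivAt.comp_hasDerivAt t (hγ t)
  -- so `m₁` agrees with `t ↦ Df(γ t) v` near `0`
  have hm₁ : m₁ =ᶠ[𝓝 0] fun t => fderiv ℝ f (γ t) v := by
    filter_upwards [h₁, hφ'] with t ht ht'
    exact ht.unique ht'
  refine ⟨?_, ?_⟩
  · have h0 := hm₁.eq_of_nhds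
    simp only [hγ0] at h0
    exact h0.symm
  · -- second derivative of the slice at `0`
    have h1 : HasDerivAt (fderiv ℝ f ∘ γ) (fderiv ℝ (fderiv ℝ f) (γ 0) v) 0 := by
      have hD' : DifferentiableAt ℝ (fderiv ℝ f) (γ 0) := by rw [hγ0]; exact hD
      exact hD'.hasFDerivAt.comp_hasDerivAt 0 (hγ 0)
    rw [hγ0] at h1
    have h2 := h1.clm_apply (hasDerivAt_const (0 : ℝ) v)
    simp only [ContinuousLinearMap.map_zero, add_zero, Function.comp_apply] at h2
    -- `h2 : HasDerivAt (fun t => fderiv ℝ f (γ t) v) (fderiv ℝ (fderiv ℝ f) z v v) 0`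
    have h3 : HasDerivAt m₁ (fderiv ℝ (fderiv ℝ f) z v v) 0 := h2.congr_of_eventuallyEq hm₁
    rw [iteratedFDeriv_two_apply]
    simpa using (h₂.unique h3).symm

/-! ### Holomorphic functions: real derivative and slices -/

/-- For a holomorphic `h`, the real derivative is multiplication by `deriv h`
(copied from `CertificatePullback.lean`). -/
private theorem fderiv_real_apply {h : ℂ → ℂ} {w : ℂ} (hh : DifferentiableAt ℂ h w) (v : ℂ) :
    fderiv ℝ h w v = deriv h w * v := by
  rw [hh.hasDerivAt.complexToReal_fderiv.fderiv, smul_apply,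
    one_apply_eq_self, smul_eq_mul]

/-- Slice of a holomorphic `h` along the real line `s ↦ z + s v`, at a parameter `t` with
`z + t v ∈ U` (copied from `CertificatePullback.lean`). -/
private theorem hasDerivAt_hol_line {h : ℂ → ℂ} {U : Set ℂ} (hh : DifferentiableOn ℂ h U)
    (hU : IsOpen U) (z v : ℂ) {t : ℝ} (ht : z + t * v ∈ U) :
    HasDerivAt (fun s : ℝ => h (z + s * v)) (deriv h (z + t * v) * v) t := by
  have h1 : HasDerivAt h (deriv h (z + t * v)) (z + t * v) :=
    (hh.differentiableAt (hU.mem_nhds ht)).hasDerivAt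
  have h2 : HasDerivAt (fun ζ : ℂ => z + ζ * v) v (t : ℂ) := by
    simpa using ((hasDerivAt_id (t : ℂ)).mul_const v).const_add z
  exact (h1.comp (t : ℂ) h2).comp_ofReal

/-- **Slice computation.** For `h₁, h₂` holomorphic on the open set `U ∋ z`, the first two
derivatives at `z` in the direction `v` of `|h₁|² + |h₂|²` are `2⟨h₁, h₁' v⟩ + 2⟨h₂, h₂' v⟩` and
`2(⟨h₁, h₁'' v v⟩ + ⟨h₁' v, h₁' v⟩) + 2(⟨h₂, h₂'' v v⟩ + ⟨h₂' v, h₂' v⟩)` (all functions evaluated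
at `z`). -/
private theorem slice {h₁ h₂ : ℂ → ℂ} {U : Set ℂ} {z : ℂ} (hU : IsOpen U) (hz : z ∈ U)
    (hh₁ : DifferentiableOn ℂ h₁ U) (hh₂ : DifferentiableOn ℂ h₂ U) (v : ℂ) :
    fderiv ℝ (fun w => ‖h₁ w‖ ^ 2 + ‖h₂ w‖ ^ 2) z v =
        2 * ⟪h₁ z, deriv h₁ z * v⟫ + 2 * ⟪h₂ z, deriv h₂ z * v⟫ ∧
      iteratedFDeriv ℝ 2 (fun w => ‖h₁ w‖ ^ 2 + ‖h₂ w‖ ^ 2) z ![v, v] =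
        2 * (⟪h₁ z, deriv (deriv h₁) z * v * v⟫ + ⟪deriv h₁ z * v, deriv h₁ z * v⟫) +
          2 * (⟪h₂ z, deriv (deriv h₂) z * v * v⟫ + ⟪deriv h₂ z * v, deriv h₂ z * v⟫) := by
  have hγ0 : z + ((0 : ℝ) : ℂ) * v = z := by simp
  have h0U : z + ((0 : ℝ) : ℂ) * v ∈ U := by rw [hγ0]; exact hz
  -- the function is `C²` at `z`
  have hc₁ : ContDiffAt ℝ 2 h₁ z := (hh₁.analyticAt (hU.mem_nhds hz)).contDiffAt.restrict_scalars ℝ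
  have hc₂ : ContDiffAt ℝ 2 h₂ z := (hh₂.analyticAt (hU.mem_nhds hz)).contDiffAt.restrict_scalars ℝ
  have hf : ContDiffAt ℝ 2 (fun w => ‖h₁ w‖ ^ 2 + ‖h₂ w‖ ^ 2) z :=
    (hc₁.norm_sq ℝ).add (hc₂.norm_sq ℝ)
  -- the line stays in `U` near `t = 0`
  have hc : Continuous fun t : ℝ => z + (t : ℂ) * v := by fun_prop
  have hU' : ∀ᶠ t : ℝ in 𝓝 0, z + (t : ℂ) * v ∈ U :=
    hc.continuousAt.preimage_mem_nhds (by simpa using hU.mem_nhds hz)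
  -- first derivative of the slice near `0`
  have h₁' : ∀ᶠ t : ℝ in 𝓝 0,
      HasDerivAt (fun s : ℝ => ‖h₁ (z + s * v)‖ ^ 2 + ‖h₂ (z + s * v)‖ ^ 2)
        (2 * ⟪h₁ (z + t * v), deriv h₁ (z + t * v) * v⟫ +
          2 * ⟪h₂ (z + t * v), deriv h₂ (z + t * v) * v⟫) t := by
    filter_upwards [hU'] with t ht
    exact (hasDerivAt_hol_line hh₁ hU z v ht).norm_sq.add
      (hasDerivAt_hol_line hh₂ hU z v ht).norm_sq
  -- derivatives at `0` of the factors
  have ha₁ : HasDerivAt (fun s : ℝ => h₁ (z + s * v)) (deriv h₁ z * v) 0 := by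
    have h := hasDerivAt_hol_line hh₁ hU z v h0U
    rwa [hγ0] at h
  have hb₁ : HasDerivAt (fun s : ℝ => deriv h₁ (z + s * v)) (deriv (deriv h₁) z * v) 0 := by
    have h := hasDerivAt_hol_line (hh₁.deriv hU) hU z v h0U
    rwa [hγ0] at h
  have ha₂ : HasDerivAt (fun s : ℝ => h₂ (z + s * v)) (deriv h₂ z * v) 0 := by
    have h := hasDerivAt_hol_line hh₂ hU z v h0U
    rwa [hγ0] at h
  have hb₂ : HasDerivAt (fun s : ℝ => deriv h₂ (z + s * v)) (deriv (deriv h₂) z * v) 0 := by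
    have h := hasDerivAt_hol_line (hh₂.deriv hU) hU z v h0U
    rwa [hγ0] at h
  -- second derivative of the slice at `0`
  have h₂' := ((ha₁.inner ℝ (hb₁.mul_const v)).const_mul (2 : ℝ)).add
    ((ha₂.inner ℝ (hb₂.mul_const v)).const_mul (2 : ℝ))
  rw [hγ0] at h₂'
  obtain ⟨e1, e2⟩ := fderiv_iteratedFDeriv_of_line hf h₁' h₂'
  refine ⟨?_, e2⟩
  rw [e1, hγ0]

/-! ### Pointwise algebra -/

/-- Inner products and norms on `ℂ = ℝ²` in coordinates, and the cancellation of the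
`⟨h, h'' v v⟩` terms between the directions `v = 1` and `v = I`. -/
private theorem inner_facts (a b e : ℂ) :
    ‖a‖ ^ 2 = a.re ^ 2 + a.im ^ 2 ∧ ⟪a, b * 1⟫ = a.re * b.re + a.im * b.im ∧
      ⟪a, b * I⟫ = a.im * b.re - a.re * b.im ∧ ⟪b * 1, b * 1⟫ = b.re ^ 2 + b.im ^ 2 ∧
      ⟪b * I, b * I⟫ = b.re ^ 2 + b.im ^ 2 ∧ ⟪a, e * 1 * 1⟫ + ⟪a, e * I * I⟫ = 0 := by
  simp only [Complex.inner, mul_one, mul_re, mul_im, conj_re, conj_im, I_re, I_im, mul_zero,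
    zero_sub, add_zero, Complex.sq_norm, Complex.normSq_apply]
  refine ⟨by ring, by ring, by ring, by ring, by ring, by ring⟩

/-- **The algebra (Lagrange's identity).** In the coordinates of `inner_facts`,
`m Δm - |∇m|² = 4 |h₁ h₂' - h₂ h₁'|² ≥ 0`. -/
private theorem algebra_step
    {N₁ N₂ X₁ X₂ Y₁ Y₂ B₁ B₁' B₂ B₂' E₁ E₁' E₂ E₂' p₁ q₁ r₁ s₁ p₂ q₂ r₂ s₂ : ℝ}
    (hN₁ : N₁ = p₁ ^ 2 + q₁ ^ 2) (hX₁ : X₁ = p₁ * r₁ + q₁ * s₁) (hY₁ : Y₁ = q₁ * r₁ - p₁ * s₁)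
    (hB₁ : B₁ = r₁ ^ 2 + s₁ ^ 2) (hB₁' : B₁' = r₁ ^ 2 + s₁ ^ 2) (hE₁ : E₁ + E₁' = 0)
    (hN₂ : N₂ = p₂ ^ 2 + q₂ ^ 2) (hX₂ : X₂ = p₂ * r₂ + q₂ * s₂) (hY₂ : Y₂ = q₂ * r₂ - p₂ * s₂)
    (hB₂ : B₂ = r₂ ^ 2 + s₂ ^ 2) (hB₂' : B₂' = r₂ ^ 2 + s₂ ^ 2) (hE₂ : E₂ + E₂' = 0) :
    0 ≤ (N₁ + N₂) * ((2 * (E₁ + B₁) + 2 * (E₂ + B₂)) + (2 * (E₁' + B₁') + 2 * (E₂' + B₂'))) -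
      ((2 * X₁ + 2 * X₂) ^ 2 + (2 * Y₁ + 2 * Y₂) ^ 2) := by
  have key : (N₁ + N₂) * ((2 * (E₁ + B₁) + 2 * (E₂ + B₂)) + (2 * (E₁' + B₁') + 2 * (E₂' + B₂'))) -
      ((2 * X₁ + 2 * X₂) ^ 2 + (2 * Y₁ + 2 * Y₂) ^ 2) =
        4 * ((p₁ * r₂ - q₁ * s₂ - p₂ * r₁ + q₂ * s₁) ^ 2 +
          (p₁ * s₂ + q₁ * r₂ - p₂ * s₁ - q₂ * r₁) ^ 2) := by
    rw [hN₁, hX₁, hY₁, hB₁, hB₁', hN₂, hX₂, hY₂, hB₂, hB₂']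
    linear_combination (2 * (p₁ ^ 2 + q₁ ^ 2 + (p₂ ^ 2 + q₂ ^ 2))) * hE₁ +
      (2 * (p₁ ^ 2 + q₁ ^ 2 + (p₂ ^ 2 + q₂ ^ 2))) * hE₂
  rw [key]
  positivity

/-! ### The helper -/

/-- helper (T3): **the speed of a standard `J₀`-curve.**  If `g : ℂ → ℝ⁴` is smooth on the open
set `U` with `Dg(z)(I ζ) = J₀ (Dg(z) ζ)` on `U`, then `m(w) = ‖Dg(w) 1‖²` is smooth on `U` and
`0 ≤ m Δm - |∇m|²` on `U`. -/
theorem helper_frozen_normSqDeriv : ∀ (U : Set ℂ) (g : ℂ → EuclideanSpace ℝ (Fin 4)), IsOpen U →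
    ContDiffOn ℝ ∞ g U →
    (∀ z ∈ U, ∀ ζ : ℂ, fderiv ℝ g z (Complex.I * ζ) =
      Literature.Geometry.Symplectic.stdComplexStructure (fderiv ℝ g z ζ)) →
    ContDiffOn ℝ ∞ (fun w => ‖fderiv ℝ g w 1‖ ^ 2) U ∧
      ∀ z ∈ U, 0 ≤ ‖fderiv ℝ g z 1‖ ^ 2 * (Δ (fun w => ‖fderiv ℝ g w 1‖ ^ 2)) z -
        ((fderiv ℝ (fun w => ‖fderiv ℝ g w 1‖ ^ 2) z 1) ^ 2 +
          (fderiv ℝ (fun w => ‖fderiv ℝ g w 1‖ ^ 2) z Complex.I) ^ 2) := by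
  intro U g hU hg hJ
  obtain ⟨π₁, hπ₁⟩ := exists_clm_coordPair 0 1
  obtain ⟨π₂, hπ₂⟩ := exists_clm_coordPair 2 3
  -- real differentiability of `g` on `U`
  have hd : ∀ z ∈ U, DifferentiableAt ℝ g z := fun z hz =>
    ((hg z hz).contDiffAt (hU.mem_nhds hz)).differentiableAt (by simp)
  -- the complex coordinates of `g` are holomorphic on `U`
  set g₁ : ℂ → ℂ := fun z => π₁ (g z)
  set g₂ : ℂ → ℂ := fun z => π₂ (g z)
  have hD₁ : ∀ z ∈ U, HasFDerivAt g₁ (π₁.comp (fderiv ℝ g z)) z := fun z hz =>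
    π₁.hasFDerivAt.comp z (hd z hz).hasFDerivAt
  have hD₂ : ∀ z ∈ U, HasFDerivAt g₂ (π₂.comp (fderiv ℝ g z)) z := fun z hz =>
    π₂.hasFDerivAt.comp z (hd z hz).hasFDerivAt
  have hg₁C : DifferentiableOn ℂ g₁ U := fun z hz =>
    (differentiableAt_complex_of_hasFDerivAt (hD₁ z hz) fun ζ => by
      rw [ContinuousLinearMap.comp_apply, ContinuousLinearMap.comp_apply, hJ z hz ζ, hπ₁, hπ₁]
      exact coordPair_stdComplexStructure_zero_one _).differentiableWithinAt
  have hg₂C : DifferentiableOn ℂ g₂ U := fun z hz =>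
    (differentiableAt_complex_of_hasFDerivAt (hD₂ z hz) fun ζ => by
      rw [ContinuousLinearMap.comp_apply, ContinuousLinearMap.comp_apply, hJ z hz ζ, hπ₂, hπ₂]
      exact coordPair_stdComplexStructure_two_three _).differentiableWithinAt
  -- their derivatives `h_j = g_j'` are holomorphic, and give the coordinates of `Dg(w) 1`
  have hh₁ : DifferentiableOn ℂ (deriv g₁) U := hg₁C.deriv hU
  have hh₂ : DifferentiableOn ℂ (deriv g₂) U := hg₂C.deriv hU
  have key₁ : ∀ w ∈ U, π₁ (fderiv ℝ g w 1) = deriv g₁ w := fun w hw => by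
    rw [← mul_one (deriv g₁ w), ← fderiv_real_apply (hg₁C.differentiableAt (hU.mem_nhds hw)) 1,
      (hD₁ w hw).fderiv, ContinuousLinearMap.comp_apply]
  have key₂ : ∀ w ∈ U, π₂ (fderiv ℝ g w 1) = deriv g₂ w := fun w hw => by
    rw [← mul_one (deriv g₂ w), ← fderiv_real_apply (hg₂C.differentiableAt (hU.mem_nhds hw)) 1,
      (hD₂ w hw).fderiv, ContinuousLinearMap.comp_apply]
  have heq : ∀ w ∈ U, ‖fderiv ℝ g w 1‖ ^ 2 = ‖deriv g₁ w‖ ^ 2 + ‖deriv g₂ w‖ ^ 2 :=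
    fun w hw => by
    rw [norm_sq_eq_coordPair, ← hπ₁ (fderiv ℝ g w 1), ← hπ₂ (fderiv ℝ g w 1), key₁ w hw,
      key₂ w hw]
  refine ⟨?_, fun z hz => ?_⟩
  · -- smoothness
    have h1 : ContDiffOn ℝ ∞ (fun w => ‖deriv g₁ w‖ ^ 2) U :=
      ((hh₁.contDiffOn hU).restrict_scalars ℝ).norm_sq ℝ
    have h2 : ContDiffOn ℝ ∞ (fun w => ‖deriv g₂ w‖ ^ 2) U :=
      ((hh₂.contDiffOn hU).restrict_scalars ℝ).norm_sq ℝ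
    exact (h1.add h2).congr heq
  · -- the inequality at `z ∈ U`
    have hev : (fun w => ‖fderiv ℝ g w 1‖ ^ 2) =ᶠ[𝓝 z]
        fun w => ‖deriv g₁ w‖ ^ 2 + ‖deriv g₂ w‖ ^ 2 :=
      Filter.eventually_of_mem (hU.mem_nhds hz) heq
    obtain ⟨e1, e2⟩ := slice hU hz hh₁ hh₂ 1
    obtain ⟨f1, f2⟩ := slice hU hz hh₁ hh₂ I
    obtain ⟨i1, i2, i3, i4, i5, i6⟩ :=
      inner_facts (deriv g₁ z) (deriv (deriv g₁) z) (deriv (deriv (deriv g₁)) z)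
    obtain ⟨j1, j2, j3, j4, j5, j6⟩ :=
      inner_facts (deriv g₂ z) (deriv (deriv g₂) z) (deriv (deriv (deriv g₂)) z)
    rw [hev.fderiv_eq, (InnerProductSpace.laplacian_congr_nhds hev).eq_of_nhds, heq z hz,
      InnerProductSpace.laplacian_eq_iteratedFDeriv_complexPlane]
    beta_reduce
    rw [e1, e2, f1, f2]
    exact algebra_step i1 i2 i3 i4 i5 i6 j1 j2 j3 j4 j5 j6

end Summit.SmoothPoincare4.SmoothPoincare4.Theorems.HyperbolicEnd.Negative

end
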